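import Summits.Ventures.PercRepro.RankLevelSetRuleQCornerReduction
import Summits.Ventures.PercRepro.RankLevelSetRuleQCornerLargeQ

/-!
# PercRepro — THE WHOLE UNTRUNCATED REGIME OF EVERY FAMILY `k ≥ 3` FOR EVERY `q ≥ 4k⁴`, UNIFORMLY IN `k`
(p4, gen 28; C-044; paper proofs/P4-CELL-THREE.md §13.11.7)

**`rhat_whole_of_large_q (q k m) (hk : 3 ≤ k) (hq : 4·k⁴ ≤ q) (hm : m + k ≤ q + 1) : phiK (q+k) q ≤ rhat q k m`** —
the corner `#P = q − k + 1` for `q ≥ 4k⁴` (RankLevelSetRuleQCornerLargeQ) and the reduction of the whole untruncated regime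
to its corner (RankLevelSetRuleQCornerReduction).  Together with the row `J = 1` of RankLevelSetRuleQFullUniform (every `q`
with the row at the corner, i.e. `q ≲ k² − 2k`) the uniform-in-`k` statement is open only on the window `k² ≲ q < 4k⁴`,
for `k ≥ 18` (the ladder `k ≤ 17` is in the tree for every `q`).  Axioms standard.
-/

namespace PercRepro

/-- **THE WHOLE UNTRUNCATED REGIME FOR `q ≥ 4k⁴`, UNIFORMLY IN `k`**: Rule Q's equal split pays `Φ(q+k, q)` to every member
of every cell `(q+k, q)` with `#P ≤ q − k + 1`, for every `k ≥ 3` and every `q ≥ 4k⁴`. -/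
theorem rhat_whole_of_large_q (q k m : ℕ) (hk : 3 ≤ k) (hq : 4 * k ^ 4 ≤ q) (hm : m + k ≤ q + 1) :
    phiK (q + k) q ≤ rhat q k m := by
  have hk4 : k ≤ k ^ 4 := Nat.le_self_pow (by norm_num) k
  exact rhat_whole_of_corner q k hk (by omega) (rhat_corner_of_large_q q k hk hq) m hm

/-- The matroid form of `rhat_whole_of_large_q` (the same statement, named for the transfer). -/
theorem ruleQRecv_ge_of_large_q (q k m : ℕ) (hk : 3 ≤ k) (hq : 4 * k ^ 4 ≤ q) (hm : m + k ≤ q + 1) :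
    phiK (q + k) q ≤ rhat q k m :=
  rhat_whole_of_large_q q k m hk hq hm

end PercRepro
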